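import Mathlib
import Literature.Combinatorics.Enumerative.PatternAvoidance132Catalan
import HarnessLib

/-!
# Simion–Schmidt (1985) §3 «Double restrictions»: Lemma 5, Propositions 9 and 11

Permutations of length `n` avoiding TWO patterns of length three, stated on the tree's notion
`Literature.Combinatorics.Enumerative.PermContainsPattern` (file `BruhatIntervalRookBoards`): `v : Perm (Fin n)` contains
the word `p` iff some positions `f 0 < ⋯ < f (m−1)` carry entries in the relative order of `p`.  «Let `A_n(τ, ρ)` be the
number of `τ` and `ρ` avoiding elements of `S_n`» is `Nat.card {v : Perm (Fin n) // ¬ C v τ ∧ ¬ C v ρ}`.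

Contents (all theorems; no new notions):
* §0 word tools, public: the two- and three-letter sublists of `List.ofFn w`; «the one-line word of `v` has a
  `τ`-sublist iff `v` contains `τ`» for `τ = 231, 321`; the generic transfer
  `Nat.card {v : Perm (Fin n) // Q v} = #{arrangements l of range n | P l}` whenever `Q v ↔ P (word of v)`;
  `231`-, `123`- and `321`-sublists of a word split at its largest letter (`l₁ m l₂`).
* §1 LEMMA 5 «(a) `A_n(123,132) = A_n(123,213) = A_n(231,321) = A_n(312,321)`; (b) `A_n(132,213) = A_n(231,312)`;
  (c) `A_n(132,231) = A_n(213,312)`; (d) `A_n(132,312) = A_n(213,231)`; (e) `A_n(132,321) = A_n(123,231) =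
  A_n(123,312) = A_n(213,321)`» — from reversal and complementation (`PatternAvoidanceSymmetries`).
* §2 PROPOSITION 9 «For all `n ≥ 1`, `A_n(132, 231) = 2^{n−1}`» — as printed: «either `σ(1) = n` or `σ(n) = n` is
  forced and we have `A_n(132,231) = 2A_{n−1}(132,231)`»; first on words (arrangements of a finset of a linear order),
  then transferred; with (c), `A_n(213,312) = 2^{n−1}`.
* §3 PROPOSITION 11 «For all `n ≥ 1`, `A_n(132, 321) = C(n,2) + 1`» — split at the largest letter `m`: the letters
  after `m` increase and lie below the letters before `m`, which increase too unless nothing follows `m`; hence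
  `A_n = A_{n−1} + (n − 1)`; with (e), the same value for `(123,231)`, `(123,312)`, `(213,321)`.
(In `ℕ`, `2 ^ (0 − 1) = 1 = C(0,2) + 1 = A_0`, so the closed forms are stated for every `n`.)

## References
* [SimionSchmidt1985] R. Simion, F. W. Schmidt, Restricted permutations, European J. Combin. 6 (1985) 383–406, §3:
  Lemma 5, Propositions 9 and 11 (held text `paper:doi-10-1016-s0195-6698-85-80052-4`, p0010–p0012).
* [Bona2012] M. Bóna, Combinatorics of Permutations, 2nd ed., CRC Press 2012, §4.2 (reverse, complement; held text
  p0129), Definition 4.1 (held text p0128).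
-/

namespace Literature.Combinatorics.Enumerative

namespace PermContainsPattern

open Finset Equiv

/-! ### §0 Word tools -/

section WordTools

variable {α : Type*} {n : ℕ}

/-- Two-letter sublists of a word `w₀ w₁ ⋯ w_{n−1}` are the pairs `w_i w_j`, `i < j`.
[cite: Bona2012, Definition 4.1 (held text p0128)] -/
theorem two_sublist_ofFn_iff : ∀ {n : ℕ} (w : Fin n → α) (a b : α),
    [a, b].Sublist (List.ofFn w) ↔ ∃ i j : Fin n, i < j ∧ w i = a ∧ w j = b
  | 0, w, a, b => by simp
  | n + 1, w, a, b => by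
    rw [List.ofFn_succ, List.sublist_cons_iff, two_sublist_ofFn_iff]
    constructor
    · rintro (⟨i, j, hij, rfl, rfl⟩ | ⟨r, hr, hr'⟩)
      · exact ⟨i.succ, j.succ, Fin.succ_lt_succ_iff.mpr hij, rfl, rfl⟩
      · simp only [List.cons.injEq] at hr
        obtain ⟨rfl, rfl⟩ := hr
        obtain ⟨j, hj⟩ := List.mem_ofFn.mp (List.singleton_sublist.mp hr')
        exact ⟨0, j.succ, Fin.succ_pos j, rfl, hj⟩
    · rintro ⟨i, j, hij, rfl, rfl⟩
      rcases Fin.eq_zero_or_eq_succ i with rfl | ⟨i', rfl⟩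
      · rcases Fin.eq_zero_or_eq_succ j with rfl | ⟨j', rfl⟩
        · exact absurd hij (lt_irrefl _)
        · exact Or.inr ⟨[w j'.succ], rfl, List.singleton_sublist.mpr (List.mem_ofFn.mpr ⟨j', rfl⟩)⟩
      · rcases Fin.eq_zero_or_eq_succ j with rfl | ⟨j', rfl⟩
        · exact absurd hij (not_lt.mpr (Fin.zero_le _))
        · exact Or.inl ⟨i', j', Fin.succ_lt_succ_iff.mp hij, rfl, rfl⟩

/-- Three-letter sublists of `w₀ ⋯ w_{n−1}` are the triples `w_i w_j w_k`, `i < j < k`.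
[cite: Bona2012, Definition 4.1 (held text p0128)] -/
theorem three_sublist_ofFn_iff : ∀ {n : ℕ} (w : Fin n → α) (a b c : α),
    [a, b, c].Sublist (List.ofFn w) ↔ ∃ i j k : Fin n, i < j ∧ j < k ∧ w i = a ∧ w j = b ∧ w k = c
  | 0, w, a, b, c => by simp
  | n + 1, w, a, b, c => by
    rw [List.ofFn_succ, List.sublist_cons_iff, three_sublist_ofFn_iff]
    constructor
    · rintro (⟨i, j, k, hij, hjk, rfl, rfl, rfl⟩ | ⟨r, hr, hr'⟩)
      · exact ⟨i.succ, j.succ, k.succ, Fin.succ_lt_succ_iff.mpr hij, Fin.succ_lt_succ_iff.mpr hjk, rfl, rfl, rfl⟩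
      · simp only [List.cons.injEq] at hr
        obtain ⟨rfl, rfl⟩ := hr
        obtain ⟨j, k, hjk, hj, hk⟩ := (two_sublist_ofFn_iff _ b c).mp hr'
        exact ⟨0, j.succ, k.succ, Fin.succ_pos j, Fin.succ_lt_succ_iff.mpr hjk, rfl, hj, hk⟩
    · rintro ⟨i, j, k, hij, hjk, rfl, rfl, rfl⟩
      rcases Fin.eq_zero_or_eq_succ j with rfl | ⟨j', rfl⟩
      · exact absurd hij (not_lt.mpr (Fin.zero_le _))
      rcases Fin.eq_zero_or_eq_succ k with rfl | ⟨k', rfl⟩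
      · exact absurd hjk (not_lt.mpr (Fin.zero_le _))
      rcases Fin.eq_zero_or_eq_succ i with rfl | ⟨i', rfl⟩
      · exact Or.inr ⟨[w j'.succ, w k'.succ], rfl,
          (two_sublist_ofFn_iff _ _ _).mpr ⟨j', k', Fin.succ_lt_succ_iff.mp hjk, rfl, rfl⟩⟩
      · exact Or.inl ⟨i', j', k', Fin.succ_lt_succ_iff.mp hij, Fin.succ_lt_succ_iff.mp hjk, rfl, rfl, rfl⟩

/-- A word `w₀ ⋯ w_{n−1}` has a two-letter sublist in a prescribed relation iff two positions `i < j` carry letters in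
that relation. [cite: Bona2012, Definition 4.1 (held text p0128)] -/
theorem exists_two_sublist_ofFn_iff (w : Fin n → α) (R : α → α → Prop) :
    (∃ a b : α, [a, b].Sublist (List.ofFn w) ∧ R a b) ↔ ∃ i j : Fin n, i < j ∧ R (w i) (w j) := by
  constructor
  · rintro ⟨a, b, hs, h⟩
    obtain ⟨i, j, hij, rfl, rfl⟩ := (two_sublist_ofFn_iff w a b).mp hs
    exact ⟨i, j, hij, h⟩
  · rintro ⟨i, j, hij, h⟩
    exact ⟨w i, w j, (two_sublist_ofFn_iff w _ _).mpr ⟨i, j, hij, rfl, rfl⟩, h⟩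

/-- A word `w₀ ⋯ w_{n−1}` has a three-letter sublist in a prescribed relation (a pattern) iff three positions
`i < j < k` carry letters in that relation. [cite: Bona2012, Definition 4.1 (held text p0128)] -/
theorem exists_three_sublist_ofFn_iff (w : Fin n → α) (R : α → α → α → Prop) :
    (∃ a b c : α, [a, b, c].Sublist (List.ofFn w) ∧ R a b c) ↔
      ∃ i j k : Fin n, i < j ∧ j < k ∧ R (w i) (w j) (w k) := by
  constructor
  · rintro ⟨a, b, c, hs, h⟩
    obtain ⟨i, j, k, hij, hjk, rfl, rfl, rfl⟩ := (three_sublist_ofFn_iff w a b c).mp hs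
    exact ⟨i, j, k, hij, hjk, h⟩
  · rintro ⟨i, j, k, hij, hjk, h⟩
    exact ⟨w i, w j, w k, (three_sublist_ofFn_iff w _ _ _).mpr ⟨i, j, k, hij, hjk, rfl, rfl, rfl⟩, h⟩

/-- The one-line word of `v` has a `231`-sublist (`a b c` with `c < a < b`) iff `v` contains `231`.
[cite: SimionSchmidt1985, §1 (held text p0002)] -/
theorem has231_ofFn_perm_iff (v : Perm (Fin n)) :
    (∃ a b c : ℕ, [a, b, c].Sublist (List.ofFn fun i => (v i : ℕ)) ∧ c < a ∧ a < b) ↔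
      PermContainsPattern v ![2, 3, 1] := by
  rw [contains_231_iff]
  refine (exists_three_sublist_ofFn_iff _ (fun a b c => c < a ∧ a < b)).trans ?_
  simp only [Fin.val_fin_lt]

/-- The one-line word of `v` has a `321`-sublist (`a b c` with `c < b < a`) iff `v` contains `321`.
[cite: SimionSchmidt1985, §1 (held text p0002)] -/
theorem has321_ofFn_perm_iff (v : Perm (Fin n)) :
    (∃ a b c : ℕ, [a, b, c].Sublist (List.ofFn fun i => (v i : ℕ)) ∧ c < b ∧ b < a) ↔
      PermContainsPattern v ![3, 2, 1] := by
  rw [contains_321_iff]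
  refine (exists_three_sublist_ofFn_iff _ (fun a b c => c < b ∧ b < a)).trans ?_
  simp only [Fin.val_fin_lt]

/-- A duplicate-free list enumerating a finset `T` has `#T` entries. [folklore] -/
private theorem length_eq_card_of_mem_iff [DecidableEq α] {l : List α} {T : Finset α} (hn : l.Nodup)
    (h : ∀ x, x ∈ l ↔ x ∈ T) : l.length = T.card := by
  rw [← List.toFinset_card_of_nodup hn]
  congr 1
  ext x
  rw [List.mem_toFinset, h]

/-- **Transfer.** The one-line words of the permutations of `{0, …, n−1}` are exactly the arrangements of `range n`:
for a property `Q` of permutations that is a property `P` of their words, `#{v | Q v} = #{arrangements l | P l}`.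
[cite: Bona2012, Definition 4.1 (held text p0128)] -/
theorem card_filter_perm_eq_card_filter_arrangements (n : ℕ) (Q : Perm (Fin n) → Prop) [DecidablePred Q]
    (P : List ℕ → Prop) [DecidablePred P] (hQP : ∀ v : Perm (Fin n), Q v ↔ P (List.ofFn fun i => (v i : ℕ))) :
    (Finset.univ.filter Q).card = ((Multiset.lists (Finset.range n).val).toFinset.filter P).card := by
  refine Finset.card_bij (fun (v : Perm (Fin n)) _ => List.ofFn fun i => (v i : ℕ)) (fun v hv => ?_)
    (fun v _ v' _ h => ?_) (fun l hl => ?_)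
  · rw [Finset.mem_filter, mem_lists_toFinset_iff, ← hQP]
    refine ⟨⟨List.nodup_ofFn.mpr (Fin.val_injective.comp v.injective), fun x => ?_⟩, (Finset.mem_filter.mp hv).2⟩
    rw [List.mem_ofFn, Finset.mem_range]
    constructor
    · rintro ⟨i, rfl⟩
      exact (v i).2
    · intro hx
      exact ⟨v.symm ⟨x, hx⟩, by simp⟩
  · exact Equiv.ext fun i => Fin.val_injective (congrFun (List.ofFn_injective h) i)
  · rw [Finset.mem_filter, mem_lists_toFinset_iff] at hl
    obtain ⟨⟨hnd, hmem⟩, hP⟩ := hl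
    have hlen : l.length = n := by rw [length_eq_card_of_mem_iff hnd hmem, Finset.card_range]
    subst hlen
    have hlt : ∀ i : Fin l.length, l[(i : ℕ)] < l.length := fun i =>
      Finset.mem_range.mp ((hmem _).mp (List.getElem_mem i.2))
    set w : Fin l.length → Fin l.length := fun i => ⟨l[(i : ℕ)], hlt i⟩ with hw
    have hwinj : Function.Injective w := fun i j h => by
      simp only [hw, Fin.mk.injEq] at h
      exact Fin.ext ((hnd.getElem_inj_iff).mp h)
    have hwbij : Function.Bijective w := Finite.injective_iff_bijective.mp hwinj
    have hword : (List.ofFn fun i => ((Equiv.ofBijective w hwbij i : Fin l.length) : ℕ)) = l := by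
      simp only [Equiv.ofBijective_apply, hw]
      exact List.ofFn_getElem (xs := l)
    refine ⟨Equiv.ofBijective w hwbij, ?_, hword⟩
    rw [Finset.mem_filter, hQP, hword]
    exact ⟨Finset.mem_univ _, hP⟩

/-- **Transfer, counted.** `A_n`-type numbers are numbers of arrangements of `{0, …, n−1}` with the corresponding word
property. [cite: Bona2012, Definition 4.1 (held text p0128)] -/
theorem natCard_perm_eq_card_filter_arrangements (n : ℕ) (Q : Perm (Fin n) → Prop) (P : List ℕ → Prop)
    [DecidablePred P] (hQP : ∀ v : Perm (Fin n), Q v ↔ P (List.ofFn fun i => (v i : ℕ))) :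
    Nat.card {v : Perm (Fin n) // Q v} = ((Multiset.lists (Finset.range n).val).toFinset.filter P).card := by
  classical
  rw [Nat.subtype_card (Finset.univ.filter Q) (fun v => by simp),
    card_filter_perm_eq_card_filter_arrangements n Q P hQP]

variable [LinearOrder α]

/-- Reversal on words: `l` has a `231`-sublist iff the reversed word has a `132`-sublist («`σ ∈ S_n(π) ⇔ σ* ∈ S_n(π*)`»).
[cite: SimionSchmidt1985, Lemma 1 (held text p0002)] -/
theorem has231_iff_has132_reverse (l : List α) :
    (∃ a b c : α, [a, b, c].Sublist l ∧ c < a ∧ a < b) ↔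
      ∃ a b c : α, [a, b, c].Sublist l.reverse ∧ a < c ∧ c < b := by
  constructor
  · rintro ⟨a, b, c, hs, hca, hab⟩
    exact ⟨c, b, a, by simpa using hs.reverse, hca, hab⟩
  · rintro ⟨a, b, c, hs, hac, hcb⟩
    exact ⟨c, b, a, by simpa using hs.reverse, hac, hcb⟩

/-- Reversal on words: `l` has a `321`-sublist iff the reversed word has a `123`-sublist.
[cite: SimionSchmidt1985, Lemma 1 (held text p0002)] -/
theorem has321_iff_has123_reverse (l : List α) :
    (∃ a b c : α, [a, b, c].Sublist l ∧ c < b ∧ b < a) ↔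
      ∃ a b c : α, [a, b, c].Sublist l.reverse ∧ a < b ∧ b < c := by
  constructor
  · rintro ⟨a, b, c, hs, hcb, hba⟩
    exact ⟨c, b, a, by simpa using hs.reverse, hcb, hba⟩
  · rintro ⟨a, b, c, hs, hab, hbc⟩
    exact ⟨c, b, a, by simpa using hs.reverse, hab, hbc⟩

/-- A `231`-pattern in `l₁ m l₂` (`m` the largest letter) lies in `l₁`, lies in `l₂`, or is `x m y` with `x ∈ l₁`,
`y ∈ l₂`, `y < x`. [cite: SimionSchmidt1985, Proposition 9 (proof, held text p0011)] -/
theorem has231_append_max_iff (l₁ l₂ : List α) (m : α) (hm₁ : ∀ x ∈ l₁, x < m) (hm₂ : ∀ y ∈ l₂, y < m) :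
    (∃ a b c : α, [a, b, c].Sublist (l₁ ++ m :: l₂) ∧ c < a ∧ a < b) ↔
      (∃ a b c : α, [a, b, c].Sublist l₁ ∧ c < a ∧ a < b) ∨ (∃ a b c : α, [a, b, c].Sublist l₂ ∧ c < a ∧ a < b) ∨
        (∃ x ∈ l₁, ∃ y ∈ l₂, y < x) := by
  rw [has231_iff_has132_reverse, has231_iff_has132_reverse l₁, has231_iff_has132_reverse l₂]
  have e : (l₁ ++ m :: l₂).reverse = l₂.reverse ++ m :: l₁.reverse := by simp
  rw [e, has132_append_max_iff l₂.reverse l₁.reverse m (fun y hy => hm₂ y (List.mem_reverse.mp hy))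
    (fun x hx => hm₁ x (List.mem_reverse.mp hx))]
  constructor
  · rintro (h | h | ⟨y, hy, x, hx, hyx⟩)
    · exact Or.inr (Or.inl h)
    · exact Or.inl h
    · exact Or.inr (Or.inr ⟨x, List.mem_reverse.mp hx, y, List.mem_reverse.mp hy, hyx⟩)
  · rintro (h | h | ⟨x, hx, y, hy, hyx⟩)
    · exact Or.inr (Or.inl h)
    · exact Or.inl h
    · exact Or.inr (Or.inr ⟨y, List.mem_reverse.mpr hy, x, List.mem_reverse.mpr hx, hyx⟩)

/-- A `123`-pattern in `l₁ m l₂` (`m` the largest letter) lies in `l₂`, or ends with `m` (an ascent `a b` of `l₁`, then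
`m`), or is `x b c` with `x ∈ l₁` and an ascent `b c` of `l₂` above `x`; and conversely.
[cite: SimionSchmidt1985, Proposition 7 (proof, held text p0011)] -/
theorem has123_append_max_iff (l₁ l₂ : List α) (m : α) (hm₁ : ∀ x ∈ l₁, x < m) (hm₂ : ∀ y ∈ l₂, y < m) :
    (∃ a b c : α, [a, b, c].Sublist (l₁ ++ m :: l₂) ∧ a < b ∧ b < c) ↔
      (∃ a b c : α, [a, b, c].Sublist l₂ ∧ a < b ∧ b < c) ∨ (∃ a b : α, [a, b].Sublist l₁ ∧ a < b) ∨
        (∃ x ∈ l₁, ∃ b c : α, [b, c].Sublist l₂ ∧ x < b ∧ b < c) := by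
  constructor
  · rintro ⟨a, b, c, hs, hab, hbc⟩
    rw [List.sublist_append_iff] at hs
    obtain ⟨k₁, k₂, hk, h₁, h₂⟩ := hs
    rcases k₁ with _ | ⟨x, _ | ⟨y, _ | ⟨z, k₁⟩⟩⟩
    · -- `k₁ = []`, `[a, b, c] <+ m :: l₂`
      simp only [List.nil_append] at hk
      subst hk
      rcases List.sublist_cons_iff.mp h₂ with h₂ | ⟨r, hr, hr₂⟩
      · exact Or.inl ⟨a, b, c, h₂, hab, hbc⟩
      · simp only [List.cons.injEq] at hr
        obtain ⟨rfl, rfl⟩ := hr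
        have hb : b ∈ l₂ := hr₂.subset (by simp)
        exact absurd (hm₂ b hb) (not_lt.mpr hab.le)
    · -- `k₁ = [a] <+ l₁`, `[b, c] <+ m :: l₂`
      simp only [List.cons_append, List.nil_append, List.cons.injEq] at hk
      have ha : a ∈ l₁ := hk.1 ▸ h₁.subset (List.mem_singleton_self x)
      have h₂' : [b, c].Sublist (m :: l₂) := hk.2 ▸ h₂
      rcases List.sublist_cons_iff.mp h₂' with h₃ | ⟨r, hr, hr₂⟩
      · exact Or.inr (Or.inr ⟨a, ha, b, c, h₃, hab, hbc⟩)
      · simp only [List.cons.injEq] at hr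
        have hc : c ∈ l₂ := (hr.2 ▸ hr₂).subset (by simp)
        exact absurd (hr.1 ▸ hm₂ c hc) (not_lt.mpr hbc.le)
    · -- `k₁ = [a, b] <+ l₁`
      simp only [List.cons_append, List.nil_append, List.cons.injEq] at hk
      exact Or.inr (Or.inl ⟨a, b, hk.1 ▸ hk.2.1 ▸ h₁, hab⟩)
    · -- `k₁ = [a, b, c] <+ l₁`
      have hk' : k₁ = [] ∧ k₂ = [] := by
        have hl := congrArg List.length hk
        simp only [List.length_cons, List.length_append, List.length_nil] at hl
        constructor <;> exact List.eq_nil_of_length_eq_zero (by omega)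
      obtain ⟨rfl, rfl⟩ := hk'
      simp only [List.cons_append, List.nil_append, List.cons.injEq, and_true] at hk
      have h₁' : [a, b, c].Sublist l₁ := hk.1 ▸ hk.2.1 ▸ hk.2.2 ▸ h₁
      exact Or.inr (Or.inl ⟨a, b, (List.cons_sublist_cons.mpr (List.cons_sublist_cons.mpr
        (List.nil_sublist [c]))).trans h₁', hab⟩)
  · rintro (⟨a, b, c, hs, hab, hbc⟩ | ⟨a, b, hs, hab⟩ | ⟨x, hx, b, c, hs, hxb, hbc⟩)
    · exact ⟨a, b, c, (hs.trans (List.sublist_cons_self m l₂)).trans (List.sublist_append_right l₁ (m :: l₂)),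
        hab, hbc⟩
    · refine ⟨a, b, m, ?_, hab, hm₁ b (hs.subset (by simp))⟩
      have h2 : [m].Sublist (m :: l₂) := List.singleton_sublist.mpr List.mem_cons_self
      exact hs.append h2
    · refine ⟨x, b, c, ?_, hxb, hbc⟩
      have h1 : [x].Sublist l₁ := List.singleton_sublist.mpr hx
      exact h1.append (hs.trans (List.sublist_cons_self m l₂))

/-- A `321`-pattern in `l₁ m l₂` (`m` the largest letter) lies in `l₁`, or starts with `m` (then a descent `b c` of
`l₂`), or is a descent `a b` of `l₁` followed by a letter of `l₂` below `b`; and conversely.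
[cite: SimionSchmidt1985, Proposition 11 (proof, held text p0011)] -/
theorem has321_append_max_iff (l₁ l₂ : List α) (m : α) (hm₁ : ∀ x ∈ l₁, x < m) (hm₂ : ∀ y ∈ l₂, y < m) :
    (∃ a b c : α, [a, b, c].Sublist (l₁ ++ m :: l₂) ∧ c < b ∧ b < a) ↔
      (∃ a b c : α, [a, b, c].Sublist l₁ ∧ c < b ∧ b < a) ∨ (∃ b c : α, [b, c].Sublist l₂ ∧ c < b) ∨
        (∃ a b : α, [a, b].Sublist l₁ ∧ b < a ∧ ∃ c ∈ l₂, c < b) := by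
  rw [has321_iff_has123_reverse, has321_iff_has123_reverse l₁]
  have e : (l₁ ++ m :: l₂).reverse = l₂.reverse ++ m :: l₁.reverse := by simp
  rw [e, has123_append_max_iff l₂.reverse l₁.reverse m (fun y hy => hm₂ y (List.mem_reverse.mp hy))
    (fun x hx => hm₁ x (List.mem_reverse.mp hx))]
  refine or_congr_right (or_congr ⟨?_, ?_⟩ ⟨?_, ?_⟩)
  · rintro ⟨a, b, hs, hab⟩
    exact ⟨b, a, by simpa using hs.reverse, hab⟩
  · rintro ⟨b, c, hs, hcb⟩
    exact ⟨c, b, by simpa using hs.reverse, hcb⟩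
  · rintro ⟨x, hx, b, c, hs, hxb, hbc⟩
    exact ⟨c, b, by simpa using hs.reverse, hbc, x, List.mem_reverse.mp hx, hxb⟩
  · rintro ⟨a, b, hs, hba, c, hc, hcb⟩
    exact ⟨c, List.mem_reverse.mpr hc, b, a, by simpa using hs.reverse, hcb, hba⟩

/-- An increasing word has no `132`-sublist. [cite: SimionSchmidt1985, Proposition 11 (proof, held text p0011)] -/
theorem not_has132_of_pairwise_lt {l : List α} (h : l.Pairwise (· < ·)) :
    ¬ ∃ a b c : α, [a, b, c].Sublist l ∧ a < c ∧ c < b := by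
  rintro ⟨a, b, c, hs, -, hcb⟩
  have hp := h.sublist hs
  simp only [List.pairwise_cons, List.mem_cons, forall_eq_or_imp, List.not_mem_nil, IsEmpty.forall_iff,
    implies_true, List.Pairwise.nil, and_true] at hp
  exact absurd hp.2 (not_lt.mpr hcb.le)

/-- An increasing word has no `321`-sublist. [cite: SimionSchmidt1985, Proposition 11 (proof, held text p0011)] -/
theorem not_has321_of_pairwise_lt {l : List α} (h : l.Pairwise (· < ·)) :
    ¬ ∃ a b c : α, [a, b, c].Sublist l ∧ c < b ∧ b < a := by
  rintro ⟨a, b, c, hs, hcb, -⟩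
  have hp := h.sublist hs
  simp only [List.pairwise_cons, List.mem_cons, forall_eq_or_imp, List.not_mem_nil, IsEmpty.forall_iff,
    implies_true, List.Pairwise.nil, and_true] at hp
  exact absurd hp.2 (not_lt.mpr hcb.le)

/-- An increasing word has no descent `b c`, `c < b`. [cite: SimionSchmidt1985, Proposition 11 (proof, held text p0011)] -/
theorem not_has21_of_pairwise_lt {l : List α} (h : l.Pairwise (· < ·)) :
    ¬ ∃ b c : α, [b, c].Sublist l ∧ c < b := by
  rintro ⟨b, c, hs, hcb⟩
  exact absurd (List.pairwise_iff_forall_sublist.mp h hs) (not_lt.mpr hcb.le)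

/-- A duplicate-free word with no descent is increasing. [cite: SimionSchmidt1985, Proposition 11 (proof, held text p0011)] -/
theorem pairwise_lt_of_not_has21 {l : List α} (hn : l.Nodup) (h : ¬ ∃ b c : α, [b, c].Sublist l ∧ c < b) :
    l.Pairwise (· < ·) :=
  List.pairwise_iff_forall_sublist.mpr fun {a b} hs =>
    lt_of_le_of_ne (not_lt.mp fun hba => h ⟨a, b, hs, hba⟩) fun hab => by
      have := hn.sublist hs
      simp [hab] at this

/-- The increasing arrangement of a finset is its only increasing arrangement.
[cite: SimionSchmidt1985, Proposition 11 (proof, held text p0011)] -/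
theorem eq_sort_of_pairwise_lt {l : List α} {T : Finset α} (h : l.Pairwise (· < ·)) (hmem : ∀ x, x ∈ l ↔ x ∈ T) :
    l = T.sort := by
  refine h.eq_of_mem_iff (T.sortedLT_sort).pairwise fun x => ?_
  rw [hmem, Finset.mem_sort]

end WordTools

/-! ### §1 LEMMA 5 — the symmetry classes of pairs of patterns -/

section Lemma5

variable {n m m' : ℕ}

/-- Reversal acts on pairs of restrictions: `A_n(p, q) = A_n(p^r, q^r)`. [cite: SimionSchmidt1985, Lemma 5 (proof) and
Lemma 1 (held text p0010, p0002)] -/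
theorem card_av_pair_reverse (n : ℕ) (p : Fin m → ℕ) (q : Fin m' → ℕ) :
    Nat.card {v : Perm (Fin n) // ¬ PermContainsPattern v p ∧ ¬ PermContainsPattern v q} =
      Nat.card {v : Perm (Fin n) // ¬ PermContainsPattern v (p ∘ Fin.rev) ∧ ¬ PermContainsPattern v (q ∘ Fin.rev)} := by
  have hp : (p ∘ Fin.rev) ∘ Fin.rev = p := funext fun a => by simp
  have hq : (q ∘ Fin.rev) ∘ Fin.rev = q := funext fun a => by simp
  exact Nat.card_congr <| Equiv.subtypeEquiv (Equiv.mulRight Fin.revPerm) fun v => by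
    rw [Equiv.coe_mulRight, reverse_iff, reverse_iff, hp, hq]

/-- Complementation acts on pairs of restrictions: `A_n(p, q) = A_n(p^c, q^c)` (`p^c = (M − p a)_a` for any `M`
bounding the letters). [cite: SimionSchmidt1985, Lemma 5 (proof) and Lemma 1 (held text p0010, p0002)] -/
theorem card_av_pair_complement (n : ℕ) {p : Fin m → ℕ} {q : Fin m' → ℕ} {M M' : ℕ} (hM : ∀ a, p a ≤ M)
    (hM' : ∀ a, q a ≤ M') :
    Nat.card {v : Perm (Fin n) // ¬ PermContainsPattern v p ∧ ¬ PermContainsPattern v q} =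
      Nat.card {v : Perm (Fin n) //
        ¬ PermContainsPattern v (fun a => M - p a) ∧ ¬ PermContainsPattern v (fun a => M' - q a)} := by
  have h1 : ∀ a, M - p a ≤ M := fun a => Nat.sub_le M (p a)
  have h1' : ∀ a, M' - q a ≤ M' := fun a => Nat.sub_le M' (q a)
  have h2 : ∀ a b : Fin m, (M - (M - p a) < M - (M - p b) ↔ p a < p b) := fun a b => by
    have := hM a; have := hM b; constructor <;> intro <;> omega
  have h2' : ∀ a b : Fin m', (M' - (M' - q a) < M' - (M' - q b) ↔ q a < q b) := fun a b => by
    have := hM' a; have := hM' b; constructor <;> intro <;> omega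
  refine Nat.card_congr <| Equiv.subtypeEquiv (Equiv.mulLeft Fin.revPerm) fun v => ?_
  rw [Equiv.coe_mulLeft, complement_iff _ h1, complement_iff _ h1', congr_pattern h2 v, congr_pattern h2' v]

/-- The order of the two restrictions is immaterial: `A_n(p, q) = A_n(q, p)`. [cite: SimionSchmidt1985, §3 (held text p0010)] -/
theorem card_av_pair_comm (n : ℕ) (p : Fin m → ℕ) (q : Fin m' → ℕ) :
    Nat.card {v : Perm (Fin n) // ¬ PermContainsPattern v p ∧ ¬ PermContainsPattern v q} =
      Nat.card {v : Perm (Fin n) // ¬ PermContainsPattern v q ∧ ¬ PermContainsPattern v p} :=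
  Nat.card_congr <| Equiv.subtypeEquivRight fun _ => and_comm

/-- Word identities: `231^r = 132`. [cite: SimionSchmidt1985, Lemma 1 (held text p0002)] -/
theorem rev_231 : (![2, 3, 1] : Fin 3 → ℕ) ∘ Fin.rev = ![1, 3, 2] := funext fun a => by fin_cases a <;> rfl
/-- `321^r = 123`. [cite: SimionSchmidt1985, Lemma 1 (held text p0002)] -/
theorem rev_321 : (![3, 2, 1] : Fin 3 → ℕ) ∘ Fin.rev = ![1, 2, 3] := funext fun a => by fin_cases a <;> rfl
/-- `213^r = 312`. [cite: SimionSchmidt1985, Lemma 1 (held text p0002)] -/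
theorem rev_213 : (![2, 1, 3] : Fin 3 → ℕ) ∘ Fin.rev = ![3, 1, 2] := funext fun a => by fin_cases a <;> rfl
/-- `123^c = 321` (letters complemented to `4`). [cite: SimionSchmidt1985, Lemma 1 (held text p0002)] -/
theorem compl_123 : (fun a => 4 - (![1, 2, 3] : Fin 3 → ℕ) a) = ![3, 2, 1] := funext fun a => by fin_cases a <;> rfl
/-- `321^c = 123`. [cite: SimionSchmidt1985, Lemma 1 (held text p0002)] -/
theorem compl_321 : (fun a => 4 - (![3, 2, 1] : Fin 3 → ℕ) a) = ![1, 2, 3] := funext fun a => by fin_cases a <;> rfl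
/-- `231^c = 213`. [cite: SimionSchmidt1985, Lemma 1 (held text p0002)] -/
theorem compl_231 : (fun a => 4 - (![2, 3, 1] : Fin 3 → ℕ) a) = ![2, 1, 3] := funext fun a => by fin_cases a <;> rfl

/-- The letters of `123` are at most `4`. [folklore] -/
private theorem le4_123 : ∀ a, (![1, 2, 3] : Fin 3 → ℕ) a ≤ 4 := fun a => by fin_cases a <;> decide
/-- The letters of `132` are at most `4`. [folklore] -/
private theorem le4_132 : ∀ a, (![1, 3, 2] : Fin 3 → ℕ) a ≤ 4 := fun a => by fin_cases a <;> decide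
/-- The letters of `231` are at most `4`. [folklore] -/
private theorem le4_231 : ∀ a, (![2, 3, 1] : Fin 3 → ℕ) a ≤ 4 := fun a => by fin_cases a <;> decide
/-- The letters of `321` are at most `4`. [folklore] -/
private theorem le4_321 : ∀ a, (![3, 2, 1] : Fin 3 → ℕ) a ≤ 4 := fun a => by fin_cases a <;> decide

/-- LEMMA 5 (a), first equality «`A_n(123, 132) = A_n(123, 213)`» (reverse–complement).
[cite: SimionSchmidt1985, Lemma 5 (a) (held text p0010)] -/
theorem card_av123_av132_eq_card_av123_av213 (n : ℕ) :
    Nat.card {v : Perm (Fin n) // ¬ PermContainsPattern v ![1, 2, 3] ∧ ¬ PermContainsPattern v ![1, 3, 2]} =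
      Nat.card {v : Perm (Fin n) // ¬ PermContainsPattern v ![1, 2, 3] ∧ ¬ PermContainsPattern v ![2, 1, 3]} := by
  rw [card_av_pair_reverse, rev_123, rev_132, card_av_pair_complement n le4_321 le4_231, compl_321, compl_231]

/-- LEMMA 5 (a), second equality «`A_n(123, 132) = A_n(231, 321)`» (reverse).
[cite: SimionSchmidt1985, Lemma 5 (a) (held text p0010)] -/
theorem card_av123_av132_eq_card_av231_av321 (n : ℕ) :
    Nat.card {v : Perm (Fin n) // ¬ PermContainsPattern v ![1, 2, 3] ∧ ¬ PermContainsPattern v ![1, 3, 2]} =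
      Nat.card {v : Perm (Fin n) // ¬ PermContainsPattern v ![2, 3, 1] ∧ ¬ PermContainsPattern v ![3, 2, 1]} := by
  rw [card_av_pair_reverse, rev_123, rev_132, card_av_pair_comm]

/-- LEMMA 5 (a), third equality «`A_n(123, 132) = A_n(312, 321)`» (complement).
[cite: SimionSchmidt1985, Lemma 5 (a) (held text p0010)] -/
theorem card_av123_av132_eq_card_av312_av321 (n : ℕ) :
    Nat.card {v : Perm (Fin n) // ¬ PermContainsPattern v ![1, 2, 3] ∧ ¬ PermContainsPattern v ![1, 3, 2]} =
      Nat.card {v : Perm (Fin n) // ¬ PermContainsPattern v ![3, 1, 2] ∧ ¬ PermContainsPattern v ![3, 2, 1]} := by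
  rw [card_av_pair_complement n le4_123 le4_132, compl_123, compl_132, card_av_pair_comm]

/-- LEMMA 5 (b) «`A_n(132, 213) = A_n(231, 312)`» (reverse). [cite: SimionSchmidt1985, Lemma 5 (b) (held text p0010)] -/
theorem card_av132_av213_eq_card_av231_av312 (n : ℕ) :
    Nat.card {v : Perm (Fin n) // ¬ PermContainsPattern v ![1, 3, 2] ∧ ¬ PermContainsPattern v ![2, 1, 3]} =
      Nat.card {v : Perm (Fin n) // ¬ PermContainsPattern v ![2, 3, 1] ∧ ¬ PermContainsPattern v ![3, 1, 2]} := by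
  rw [card_av_pair_reverse, rev_132, rev_213]

/-- LEMMA 5 (c) «`A_n(132, 231) = A_n(213, 312)`» (complement). [cite: SimionSchmidt1985, Lemma 5 (c) (held text p0010)] -/
theorem card_av132_av231_eq_card_av213_av312 (n : ℕ) :
    Nat.card {v : Perm (Fin n) // ¬ PermContainsPattern v ![1, 3, 2] ∧ ¬ PermContainsPattern v ![2, 3, 1]} =
      Nat.card {v : Perm (Fin n) // ¬ PermContainsPattern v ![2, 1, 3] ∧ ¬ PermContainsPattern v ![3, 1, 2]} := by
  rw [card_av_pair_complement n le4_132 le4_231, compl_132, compl_231, card_av_pair_comm]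

/-- LEMMA 5 (d) «`A_n(132, 312) = A_n(213, 231)`» (reverse). [cite: SimionSchmidt1985, Lemma 5 (d) (held text p0010)] -/
theorem card_av132_av312_eq_card_av213_av231 (n : ℕ) :
    Nat.card {v : Perm (Fin n) // ¬ PermContainsPattern v ![1, 3, 2] ∧ ¬ PermContainsPattern v ![3, 1, 2]} =
      Nat.card {v : Perm (Fin n) // ¬ PermContainsPattern v ![2, 1, 3] ∧ ¬ PermContainsPattern v ![2, 3, 1]} := by
  rw [card_av_pair_reverse, rev_132, rev_312, card_av_pair_comm]

/-- LEMMA 5 (e), first equality «`A_n(132, 321) = A_n(123, 231)`» (reverse).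
[cite: SimionSchmidt1985, Lemma 5 (e) (held text p0010)] -/
theorem card_av132_av321_eq_card_av123_av231 (n : ℕ) :
    Nat.card {v : Perm (Fin n) // ¬ PermContainsPattern v ![1, 3, 2] ∧ ¬ PermContainsPattern v ![3, 2, 1]} =
      Nat.card {v : Perm (Fin n) // ¬ PermContainsPattern v ![1, 2, 3] ∧ ¬ PermContainsPattern v ![2, 3, 1]} := by
  rw [card_av_pair_reverse, rev_132, rev_321, card_av_pair_comm]

/-- LEMMA 5 (e), second equality «`A_n(132, 321) = A_n(123, 312)`» (complement).
[cite: SimionSchmidt1985, Lemma 5 (e) (held text p0010)] -/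
theorem card_av132_av321_eq_card_av123_av312 (n : ℕ) :
    Nat.card {v : Perm (Fin n) // ¬ PermContainsPattern v ![1, 3, 2] ∧ ¬ PermContainsPattern v ![3, 2, 1]} =
      Nat.card {v : Perm (Fin n) // ¬ PermContainsPattern v ![1, 2, 3] ∧ ¬ PermContainsPattern v ![3, 1, 2]} := by
  rw [card_av_pair_complement n le4_132 le4_321, compl_132, compl_321, card_av_pair_comm]

/-- LEMMA 5 (e), third equality «`A_n(132, 321) = A_n(213, 321)`» (reverse–complement).
[cite: SimionSchmidt1985, Lemma 5 (e) (held text p0010)] -/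
theorem card_av132_av321_eq_card_av213_av321 (n : ℕ) :
    Nat.card {v : Perm (Fin n) // ¬ PermContainsPattern v ![1, 3, 2] ∧ ¬ PermContainsPattern v ![3, 2, 1]} =
      Nat.card {v : Perm (Fin n) // ¬ PermContainsPattern v ![2, 1, 3] ∧ ¬ PermContainsPattern v ![3, 2, 1]} := by
  rw [card_av_pair_reverse, rev_132, rev_321, card_av_pair_complement n le4_231 le4_123, compl_231, compl_123]

end Lemma5

/-! ### §2 PROPOSITION 9 — `A_n(132, 231) = 2^{n−1}` -/

section Prop9

variable {α : Type*} [LinearOrder α]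

/-- ★★ **Proposition 9 on words.** The arrangements of a finite set `S` of letters with no `132`- and no `231`-sublist
number `2^{#S − 1}` (`1` for `S = ∅`): as printed, the largest letter is forced to the first or to the last place («either
`σ(1) = n` or `σ(n) = n`»), whence `A_n = 2A_{n−1}`, `A_1 = 1`. [cite: SimionSchmidt1985, Proposition 9 (held text p0011)] -/
theorem card_arrangements_not132_not231
    [DecidablePred fun l : List α => (¬ ∃ a b c : α, [a, b, c].Sublist l ∧ a < c ∧ c < b) ∧
      ¬ ∃ a b c : α, [a, b, c].Sublist l ∧ c < a ∧ a < b] (S : Finset α) :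
    ((Multiset.lists S.val).toFinset.filter (fun l => (¬ ∃ a b c : α, [a, b, c].Sublist l ∧ a < c ∧ c < b) ∧
      ¬ ∃ a b c : α, [a, b, c].Sublist l ∧ c < a ∧ a < b)).card = 2 ^ (S.card - 1) := by
  -- `av T` = the `(132, 231)`-avoiding arrangements of `T`
  set av : Finset α → Finset (List α) := fun T => (Multiset.lists T.val).toFinset.filter
    (fun l => (¬ ∃ a b c : α, [a, b, c].Sublist l ∧ a < c ∧ c < b) ∧
      ¬ ∃ a b c : α, [a, b, c].Sublist l ∧ c < a ∧ a < b) with hav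
  have hmem_av : ∀ (T : Finset α) (l : List α), l ∈ av T ↔ (l.Nodup ∧ ∀ x, x ∈ l ↔ x ∈ T) ∧
      (¬ ∃ a b c : α, [a, b, c].Sublist l ∧ a < c ∧ c < b) ∧ ¬ ∃ a b c : α, [a, b, c].Sublist l ∧ c < a ∧ a < b :=
    fun T l => by simp only [hav, Finset.mem_filter, mem_lists_toFinset_iff]
  have hav_empty : av ∅ = {[]} := by
    simp only [hav, lists_toFinset_empty]
    rw [Finset.filter_singleton, if_pos ⟨by rintro ⟨a, b, c, h, -⟩; simp at h, by rintro ⟨a, b, c, h, -⟩; simp at h⟩]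
  change (av S).card = 2 ^ (S.card - 1)
  obtain ⟨n, hn⟩ : ∃ n, S.card = n := ⟨_, rfl⟩
  induction n generalizing S with
  | zero =>
    rw [Finset.card_eq_zero.mp hn, hav_empty, Finset.card_singleton, Finset.card_empty]
    norm_num
  | succ n ih =>
    -- `S` has `n + 1` letters, the largest is `m`, `S' = S \ {m}` has `n`
    have hS : S.Nonempty := Finset.card_pos.mp (by omega)
    set m := S.max' hS with hm
    set S' := S.erase m with hS'def
    have hmS : m ∈ S := Finset.max'_mem S hS
    have hS' : S'.card = n := by rw [hS'def, Finset.card_erase_of_mem hmS, hn]; rfl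
    have hmS' : m ∉ S' := by rw [hS'def]; exact Finset.notMem_erase m S
    have hltm : ∀ x ∈ S', x < m := fun x hx => Finset.lt_max'_of_mem_erase_max' S hS hx
    have hmemS : ∀ x, x ∈ S ↔ x = m ∨ x ∈ S' := fun x => by
      rw [hS'def, Finset.mem_erase]
      constructor
      · intro hx
        by_cases h : x = m
        · exact Or.inl h
        · exact Or.inr ⟨h, hx⟩
      · rintro (rfl | ⟨-, hx⟩)
        · exact hmS
        · exact hx
    -- «σ(1) = n»: `m` in front of an avoider on `S'`
    have hcons : ∀ l, l ∈ av S' → m :: l ∈ av S := fun l hl => by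
      rw [hmem_av] at hl ⊢
      obtain ⟨⟨hnd, hmem⟩, h132, h231⟩ := hl
      have hlt : ∀ y ∈ l, y < m := fun y hy => hltm y ((hmem y).mp hy)
      have e132 := has132_append_max_iff [] l m (by simp) hlt
      have e231 := has231_append_max_iff [] l m (by simp) hlt
      rw [List.nil_append] at e132 e231
      refine ⟨⟨List.nodup_cons.mpr ⟨fun h => hmS' ((hmem m).mp h), hnd⟩, fun x => ?_⟩, ?_, ?_⟩
      · rw [List.mem_cons, hmemS, hmem]
      · rw [e132]
        rintro (⟨a, b, c, h, -⟩ | h | ⟨x, hx, -⟩)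
        · simp at h
        · exact h132 h
        · simp at hx
      · rw [e231]
        rintro (⟨a, b, c, h, -⟩ | h | ⟨x, hx, -⟩)
        · simp at h
        · exact h231 h
        · simp at hx
    -- «σ(n) = n»: `m` after an avoider on `S'`
    have hsnoc : ∀ l, l ∈ av S' → l ++ [m] ∈ av S := fun l hl => by
      rw [hmem_av] at hl ⊢
      obtain ⟨⟨hnd, hmem⟩, h132, h231⟩ := hl
      have hlt : ∀ y ∈ l, y < m := fun y hy => hltm y ((hmem y).mp hy)
      have e132 := has132_append_max_iff l [] m hlt (by simp)
      have e231 := has231_append_max_iff l [] m hlt (by simp)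
      refine ⟨⟨?_, fun x => ?_⟩, ?_, ?_⟩
      · rw [List.nodup_append]
        refine ⟨hnd, List.nodup_singleton m, fun x hx y hy => ?_⟩
        rw [List.mem_singleton] at hy
        subst hy
        exact (hlt x hx).ne
      · rw [List.mem_append, List.mem_singleton, hmemS, hmem, or_comm]
      · rw [e132]
        rintro (h | ⟨a, b, c, h, -⟩ | ⟨x, -, y, hy, -⟩)
        · exact h132 h
        · simp at h
        · simp at hy
      · rw [e231]
        rintro (h | ⟨a, b, c, h, -⟩ | ⟨x, -, y, hy, -⟩)
        · exact h231 h
        · simp at h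
        · simp at hy
    -- «either σ(1) = n or σ(n) = n is forced»
    have hsplit : ∀ l, l ∈ av S → ∃ l', l' ∈ av S' ∧ (l = m :: l' ∨ l = l' ++ [m]) := fun l hl => by
      rw [hmem_av] at hl
      obtain ⟨⟨hnd, hmem⟩, h132, h231⟩ := hl
      obtain ⟨l₁, l₂, rfl⟩ := List.append_of_mem ((hmem m).mpr hmS)
      have hnd' := hnd
      rw [List.nodup_append] at hnd'
      obtain ⟨hn₁, hn₂', hdis⟩ := hnd'
      rw [List.nodup_cons] at hn₂'
      obtain ⟨hm₂, hn₂⟩ := hn₂'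
      have hm₁ : m ∉ l₁ := fun h => (hdis m h m List.mem_cons_self) rfl
      have hS'₁ : ∀ x ∈ l₁, x ∈ S' := fun x hx => by
        have := (hmem x).mp (List.mem_append.mpr (Or.inl hx))
        rcases (hmemS x).mp this with rfl | h
        · exact absurd hx hm₁
        · exact h
      have hS'₂ : ∀ y ∈ l₂, y ∈ S' := fun y hy => by
        have := (hmem y).mp (List.mem_append.mpr (Or.inr (List.mem_cons_of_mem m hy)))
        rcases (hmemS y).mp this with rfl | h
        · exact absurd hy hm₂
        · exact h
      have hm₁' : ∀ x ∈ l₁, x < m := fun x hx => hltm x (hS'₁ x hx)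
      have hm₂' : ∀ y ∈ l₂, y < m := fun y hy => hltm y (hS'₂ y hy)
      by_cases h₁ : l₁ = []
      · subst h₁
        refine ⟨l₂, ?_, Or.inl (List.nil_append _)⟩
        rw [hmem_av]
        refine ⟨⟨hn₂, fun y => ⟨hS'₂ y, fun hy => ?_⟩⟩, fun h => h132 ?_, fun h => h231 ?_⟩
        · have := (hmem y).mpr ((hmemS y).mpr (Or.inr hy))
          rw [List.nil_append, List.mem_cons] at this
          rcases this with rfl | h
          · exact absurd hy hmS'
          · exact h
        · obtain ⟨a, b, c, hs, hh⟩ := h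
          exact ⟨a, b, c, hs.trans ((List.sublist_cons_self m l₂).trans (List.sublist_append_right [] _)), hh⟩
        · obtain ⟨a, b, c, hs, hh⟩ := h
          exact ⟨a, b, c, hs.trans ((List.sublist_cons_self m l₂).trans (List.sublist_append_right [] _)), hh⟩
      by_cases h₂ : l₂ = []
      · subst h₂
        refine ⟨l₁, ?_, Or.inr rfl⟩
        rw [hmem_av]
        refine ⟨⟨hn₁, fun x => ⟨hS'₁ x, fun hx => ?_⟩⟩, fun h => h132 ?_, fun h => h231 ?_⟩
        · have := (hmem x).mpr ((hmemS x).mpr (Or.inr hx))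
          rw [List.mem_append, List.mem_singleton] at this
          rcases this with h | rfl
          · exact h
          · exact absurd hx hmS'
        · obtain ⟨a, b, c, hs, hh⟩ := h
          exact ⟨a, b, c, hs.trans (List.sublist_append_left l₁ [m]), hh⟩
        · obtain ⟨a, b, c, hs, hh⟩ := h
          exact ⟨a, b, c, hs.trans (List.sublist_append_left l₁ [m]), hh⟩
      -- both sides nonempty: `x ∈ l₁`, `y ∈ l₂` give a `132` (`x < y`) or a `231` (`y < x`)
      exfalso
      obtain ⟨x, hx⟩ := List.exists_mem_of_ne_nil l₁ h₁
      obtain ⟨y, hy⟩ := List.exists_mem_of_ne_nil l₂ h₂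
      have hne : x ≠ y := hdis x hx y (List.mem_cons_of_mem m hy)
      rcases lt_or_gt_of_ne hne with hxy | hyx
      · exact h132 ((has132_append_max_iff l₁ l₂ m hm₁' hm₂').mpr (Or.inr (Or.inr ⟨x, hx, y, hy, hxy⟩)))
      · exact h231 ((has231_append_max_iff l₁ l₂ m hm₁' hm₂').mpr (Or.inr (Or.inr ⟨x, hx, y, hy, hyx⟩)))
    -- hence `av S = m · av S' ∪ av S' · m`
    have hU : av S = (av S').image (fun l => m :: l) ∪ (av S').image (fun l => l ++ [m]) := by
      ext l
      simp only [Finset.mem_union, Finset.mem_image]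
      constructor
      · intro hl
        obtain ⟨l', hl', h | h⟩ := hsplit l hl
        · exact Or.inl ⟨l', hl', h.symm⟩
        · exact Or.inr ⟨l', hl', h.symm⟩
      · rintro (⟨l', hl', rfl⟩ | ⟨l', hl', rfl⟩)
        · exact hcons l' hl'
        · exact hsnoc l' hl'
    rw [hU]
    rcases n with _ | n
    · -- `S = {m}`: both words are `[m]`
      rw [Finset.card_eq_zero.mp hS', hav_empty, hn]
      simp
    · -- `n + 1 ≥ 1` letters remain: the two families are disjoint, each of size `A_{n}`
      have ih' := ih S' hS'
      rw [hS'] at ih'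
      rw [Finset.card_union_of_disjoint, Finset.card_image_of_injective _ (List.cons_injective (a := m)),
        Finset.card_image_of_injective _ (fun l l' h => List.append_cancel_right h), ih']
      · rw [hn, Nat.add_sub_cancel, Nat.add_sub_cancel, pow_succ]
        ring
      · rw [Finset.disjoint_left]
        rintro l hl hl'
        rw [Finset.mem_image] at hl hl'
        obtain ⟨l₁, h₁, rfl⟩ := hl
        obtain ⟨l₂, h₂, he⟩ := hl'
        rw [hmem_av] at h₂
        rcases l₂ with _ | ⟨x, l₂⟩
        · -- `[m] = m :: l₁` forces `l₁ = []`, but `l₁` has `n + 1` letters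
          rw [hmem_av] at h₁
          have hlen := length_eq_card_of_mem_iff h₁.1.1 h₁.1.2
          simp only [List.nil_append, List.cons.injEq, true_and] at he
          rw [← he, hS'] at hlen
          simp at hlen
        · simp only [List.cons_append, List.cons.injEq] at he
          exact hmS' (he.1 ▸ (h₂.1.2 x).mp List.mem_cons_self)

/-- ★★★ **PROPOSITION 9 (Simion–Schmidt 1985)** «For all `n ≥ 1`, `A_n(132, 231) = 2^{n−1}`»: the number of
permutations of length `n` avoiding both `132` and `231` (stated for every `n`; both sides are `1` at `n = 0`).
[cite: SimionSchmidt1985, Proposition 9 (held text p0011)] -/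
theorem card_av132_av231 (n : ℕ) :
    Nat.card {v : Perm (Fin n) // ¬ PermContainsPattern v ![1, 3, 2] ∧ ¬ PermContainsPattern v ![2, 3, 1]} =
      2 ^ (n - 1) := by
  classical
  refine (natCard_perm_eq_card_filter_arrangements n
    (fun v : Perm (Fin n) => ¬ PermContainsPattern v ![1, 3, 2] ∧ ¬ PermContainsPattern v ![2, 3, 1])
    (fun l : List ℕ => (¬ ∃ a b c : ℕ, [a, b, c].Sublist l ∧ a < c ∧ c < b) ∧
      ¬ ∃ a b c : ℕ, [a, b, c].Sublist l ∧ c < a ∧ a < b)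
    (fun v => by rw [has132_ofFn_perm_iff, has231_ofFn_perm_iff])).trans ?_
  rw [card_arrangements_not132_not231 (α := ℕ) (Finset.range n), Finset.card_range]

/-- PROPOSITION 9, the printed recurrence «`A_n(132, 231) = 2A_{n−1}(132, 231)`» (`n ≥ 2`).
[cite: SimionSchmidt1985, Proposition 9 (held text p0011)] -/
theorem card_av132_av231_succ (n : ℕ) (hn : 1 ≤ n) :
    Nat.card {v : Perm (Fin (n + 1)) // ¬ PermContainsPattern v ![1, 3, 2] ∧ ¬ PermContainsPattern v ![2, 3, 1]} =
      2 * Nat.card {v : Perm (Fin n) // ¬ PermContainsPattern v ![1, 3, 2] ∧ ¬ PermContainsPattern v ![2, 3, 1]} := by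
  rw [card_av132_av231, card_av132_av231, Nat.add_sub_cancel]
  obtain ⟨k, rfl⟩ := Nat.exists_eq_add_of_le' hn
  rw [Nat.add_sub_cancel, pow_succ, mul_comm]

/-- PROPOSITION 9 with LEMMA 5 (c): `A_n(213, 312) = 2^{n−1}`. [cite: SimionSchmidt1985, Proposition 9 and Lemma 5 (c)
(held text p0010–p0011)] -/
theorem card_av213_av312 (n : ℕ) :
    Nat.card {v : Perm (Fin n) // ¬ PermContainsPattern v ![2, 1, 3] ∧ ¬ PermContainsPattern v ![3, 1, 2]} =
      2 ^ (n - 1) := by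
  rw [← card_av132_av231_eq_card_av213_av312, card_av132_av231]

/-- Sanity values `A_1 = 1`, `A_2 = 2`, `A_3 = 4` for `(132, 231)`. [cite: SimionSchmidt1985, Proposition 9 (held text p0011)] -/
theorem card_av132_av231_small :
    Nat.card {v : Perm (Fin 1) // ¬ PermContainsPattern v ![1, 3, 2] ∧ ¬ PermContainsPattern v ![2, 3, 1]} = 1 ∧
      Nat.card {v : Perm (Fin 2) // ¬ PermContainsPattern v ![1, 3, 2] ∧ ¬ PermContainsPattern v ![2, 3, 1]} = 2 ∧
        Nat.card {v : Perm (Fin 3) // ¬ PermContainsPattern v ![1, 3, 2] ∧ ¬ PermContainsPattern v ![2, 3, 1]} = 4 :=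
  ⟨by rw [card_av132_av231]; rfl, by rw [card_av132_av231]; rfl, by rw [card_av132_av231]; rfl⟩

end Prop9

/-! ### §3 PROPOSITION 11 — `A_n(132, 321) = C(n, 2) + 1` -/

section Prop11

variable {α : Type*} [LinearOrder α]

omit [LinearOrder α] in
/-- Lists: `l₁ ++ m :: l₂ = l₁' ++ m :: l₂'` with `m ∉ l₁, l₁'` forces `l₁ = l₁'` and `l₂ = l₂'`. [folklore] -/
private theorem append_cons_inj_of_notMem {m : α} :
    ∀ {l₁ l₁' l₂ l₂' : List α}, m ∉ l₁ → m ∉ l₁' → l₁ ++ m :: l₂ = l₁' ++ m :: l₂' → l₁ = l₁' ∧ l₂ = l₂'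
  | [], [], _, _, _, _, h => by simpa using h
  | [], x :: l₁', _, _, _, h', h => by
    simp only [List.nil_append, List.cons_append, List.cons.injEq] at h
    exact absurd (h.1 ▸ List.mem_cons_self) h'
  | x :: l₁, [], _, _, h', _, h => by
    simp only [List.nil_append, List.cons_append, List.cons.injEq] at h
    exact absurd (h.1 ▸ List.mem_cons_self) h'
  | x :: l₁, x' :: l₁', l₂, l₂', h₁, h₁', h => by
    simp only [List.cons_append, List.cons.injEq] at h
    obtain ⟨rfl, h⟩ := h
    have ih := append_cons_inj_of_notMem (List.not_mem_of_not_mem_cons h₁) (List.not_mem_of_not_mem_cons h₁') h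
    exact ⟨by rw [ih.1], ih.2⟩

/-- ★★ **Proposition 11 on words.** The arrangements of a finite set `S` of letters with no `132`- and no
`321`-sublist number `C(#S, 2) + 1`: split an avoider at its largest letter `m` as `l₁ m l₂`; the letters of `l₂` lie
below those of `l₁` (no `132`) and increase (no `321` starting with `m`); if `l₂` is empty, `l₁` is any avoider on the
other letters, and otherwise `l₁` increases too (a descent of `l₁` and a letter of `l₂` form a `321`), so that the word
is determined by the length `j ∈ [1, #S − 1]` of `l₂`.  Hence `A_n = A_{n−1} + (n − 1)`, `A_0 = 1`.
[cite: SimionSchmidt1985, Proposition 11 (held text p0011)] -/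
theorem card_arrangements_not132_not321
    [DecidablePred fun l : List α => (¬ ∃ a b c : α, [a, b, c].Sublist l ∧ a < c ∧ c < b) ∧
      ¬ ∃ a b c : α, [a, b, c].Sublist l ∧ c < b ∧ b < a] (S : Finset α) :
    ((Multiset.lists S.val).toFinset.filter (fun l => (¬ ∃ a b c : α, [a, b, c].Sublist l ∧ a < c ∧ c < b) ∧
      ¬ ∃ a b c : α, [a, b, c].Sublist l ∧ c < b ∧ b < a)).card = S.card.choose 2 + 1 := by
  -- `av T` = the `(132, 321)`-avoiding arrangements of `T`
  set av : Finset α → Finset (List α) := fun T => (Multiset.lists T.val).toFinset.filter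
    (fun l => (¬ ∃ a b c : α, [a, b, c].Sublist l ∧ a < c ∧ c < b) ∧
      ¬ ∃ a b c : α, [a, b, c].Sublist l ∧ c < b ∧ b < a) with hav
  have hmem_av : ∀ (T : Finset α) (l : List α), l ∈ av T ↔ (l.Nodup ∧ ∀ x, x ∈ l ↔ x ∈ T) ∧
      (¬ ∃ a b c : α, [a, b, c].Sublist l ∧ a < c ∧ c < b) ∧ ¬ ∃ a b c : α, [a, b, c].Sublist l ∧ c < b ∧ b < a :=
    fun T l => by simp only [hav, Finset.mem_filter, mem_lists_toFinset_iff]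
  have hav_empty : av ∅ = {[]} := by
    simp only [hav, lists_toFinset_empty]
    rw [Finset.filter_singleton, if_pos ⟨by rintro ⟨a, b, c, h, -⟩; simp at h, by rintro ⟨a, b, c, h, -⟩; simp at h⟩]
  change (av S).card = S.card.choose 2 + 1
  obtain ⟨n, hn⟩ : ∃ n, S.card = n := ⟨_, rfl⟩
  induction n generalizing S with
  | zero =>
    rw [Finset.card_eq_zero.mp hn, hav_empty, Finset.card_singleton, Finset.card_empty]
    norm_num
  | succ n ih =>
    -- `S` has `n + 1` letters, the largest is `m`, `S' = S \ {m}` has `n`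
    have hS : S.Nonempty := Finset.card_pos.mp (by omega)
    set m := S.max' hS with hm
    set S' := S.erase m with hS'def
    have hmS : m ∈ S := Finset.max'_mem S hS
    have hS' : S'.card = n := by rw [hS'def, Finset.card_erase_of_mem hmS, hn]; rfl
    have hmS' : m ∉ S' := by rw [hS'def]; exact Finset.notMem_erase m S
    have hltm : ∀ x ∈ S', x < m := fun x hx => Finset.lt_max'_of_mem_erase_max' S hS hx
    have hmemS : ∀ x, x ∈ S ↔ x = m ∨ x ∈ S' := fun x => by
      rw [hS'def, Finset.mem_erase]
      constructor
      · intro hx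
        by_cases h : x = m
        · exact Or.inl h
        · exact Or.inr ⟨h, hx⟩
      · rintro (rfl | ⟨-, hx⟩)
        · exact hmS
        · exact hx
    -- `low j` = the `j` smallest letters of `S'`
    set low : ℕ → Finset α := fun j => S'.filter (fun x => (S'.filter (· < x)).card < j) with hlow
    have hlow_sub : ∀ j, low j ⊆ S' := fun j => Finset.filter_subset _ _
    have hlow_card : ∀ j ≤ n, (low j).card = j := fun j hj => card_filter_rank_lt S' (by rw [hS']; exact hj)
    have hmA : ∀ j, m ∉ ((S' \ low j).sort : List α) := fun j h =>
      hmS' (Finset.sdiff_subset ((Finset.mem_sort _).mp h))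
    -- family 0 («`l₂` empty»): an avoider on `S'` followed by `m`
    have hsnoc : ∀ l, l ∈ av S' → l ++ [m] ∈ av S := fun l hl => by
      rw [hmem_av] at hl ⊢
      obtain ⟨⟨hnd, hmem⟩, h132, h321⟩ := hl
      have hlt : ∀ y ∈ l, y < m := fun y hy => hltm y ((hmem y).mp hy)
      have e132 := has132_append_max_iff l [] m hlt (by simp)
      have e321 := has321_append_max_iff l [] m hlt (by simp)
      refine ⟨⟨?_, fun x => ?_⟩, ?_, ?_⟩
      · rw [List.nodup_append]
        refine ⟨hnd, List.nodup_singleton m, fun x hx y hy => ?_⟩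
        rw [List.mem_singleton] at hy
        subst hy
        exact (hlt x hx).ne
      · rw [List.mem_append, List.mem_singleton, hmemS, hmem, or_comm]
      · rw [e132]
        rintro (h | ⟨a, b, c, h, -⟩ | ⟨x, -, y, hy, -⟩)
        · exact h132 h
        · simp at h
        · simp at hy
      · rw [e321]
        rintro (h | ⟨b, c, h, -⟩ | ⟨a, b, -, -, c, hc, -⟩)
        · exact h321 h
        · simp at h
        · simp at hc
    -- family `j`, `1 ≤ j ≤ n` («`l₂` the `j` smallest letters, increasing; `l₁` the rest, increasing»)
    set w : ℕ → List α := fun j => ((S' \ low j).sort : List α) ++ m :: ((low j).sort : List α) with hw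
    have hw_mem : ∀ j, w j ∈ av S := fun j => by
      rw [hmem_av]
      have hm₁ : ∀ x ∈ ((S' \ low j).sort : List α), x < m := fun x hx =>
        hltm x (Finset.sdiff_subset ((Finset.mem_sort _).mp hx))
      have hm₂ : ∀ y ∈ ((low j).sort : List α), y < m := fun y hy =>
        hltm y (hlow_sub j ((Finset.mem_sort _).mp hy))
      have hbelow : ∀ x ∈ ((S' \ low j).sort : List α), ∀ y ∈ ((low j).sort : List α), y < x := fun x hx y hy => by
        rw [Finset.mem_sort] at hx hy
        rw [Finset.mem_sdiff] at hx
        exact lt_of_mem_filter_rank_lt_of_not_mem S' j hy hx.1 hx.2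
      have hp₁ := (Finset.sortedLT_sort (S' \ low j)).pairwise
      have hp₂ := (Finset.sortedLT_sort (low j)).pairwise
      refine ⟨⟨?_, fun x => ?_⟩, ?_, ?_⟩
      · rw [List.nodup_append]
        refine ⟨Finset.sort_nodup _ _, List.nodup_cons.mpr ⟨fun h => hmS' (hlow_sub j ((Finset.mem_sort _).mp h)),
          Finset.sort_nodup _ _⟩, fun x hx y hy => ?_⟩
        rcases List.mem_cons.mp hy with rfl | hy
        · exact (hm₁ x hx).ne
        · exact (hbelow x hx y hy).ne'
      · rw [List.mem_append, List.mem_cons, Finset.mem_sort, Finset.mem_sort, Finset.mem_sdiff, hmemS]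
        constructor
        · rintro (⟨hx, -⟩ | rfl | hx)
          · exact Or.inr hx
          · exact Or.inl rfl
          · exact Or.inr (hlow_sub j hx)
        · rintro (rfl | hx)
          · exact Or.inr (Or.inl rfl)
          · by_cases h : x ∈ low j
            · exact Or.inr (Or.inr h)
            · exact Or.inl ⟨hx, h⟩
      · rw [has132_append_max_iff _ _ m hm₁ hm₂]
        rintro (h | h | ⟨x, hx, y, hy, hxy⟩)
        · exact not_has132_of_pairwise_lt hp₁ h
        · exact not_has132_of_pairwise_lt hp₂ h
        · exact absurd hxy (not_lt.mpr (hbelow x hx y hy).le)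
      · rw [has321_append_max_iff _ _ m hm₁ hm₂]
        rintro (h | h | ⟨a, b, hs, hba, -⟩)
        · exact not_has321_of_pairwise_lt hp₁ h
        · exact not_has21_of_pairwise_lt hp₂ h
        · exact not_has21_of_pairwise_lt hp₁ ⟨a, b, hs, hba⟩
    -- every avoider on `S` is in one of the families
    have hsplit : ∀ l, l ∈ av S → (∃ l', l' ∈ av S' ∧ l = l' ++ [m]) ∨ ∃ j, 1 ≤ j ∧ j ≤ n ∧ l = w j := fun l hl => by
      rw [hmem_av] at hl
      obtain ⟨⟨hnd, hmem⟩, h132, h321⟩ := hl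
      have hlen : (l.length) = n + 1 := by rw [length_eq_card_of_mem_iff hnd hmem, hn]
      obtain ⟨l₁, l₂, rfl⟩ := List.append_of_mem ((hmem m).mpr hmS)
      have hnd' := hnd
      rw [List.nodup_append] at hnd'
      obtain ⟨hn₁, hn₂', hdis⟩ := hnd'
      rw [List.nodup_cons] at hn₂'
      obtain ⟨hm₂, hn₂⟩ := hn₂'
      have hm₁ : m ∉ l₁ := fun h => (hdis m h m List.mem_cons_self) rfl
      have hS'₁ : ∀ x ∈ l₁, x ∈ S' := fun x hx => by
        have := (hmem x).mp (List.mem_append.mpr (Or.inl hx))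
        rcases (hmemS x).mp this with rfl | h
        · exact absurd hx hm₁
        · exact h
      have hS'₂ : ∀ y ∈ l₂, y ∈ S' := fun y hy => by
        have := (hmem y).mp (List.mem_append.mpr (Or.inr (List.mem_cons_of_mem m hy)))
        rcases (hmemS y).mp this with rfl | h
        · exact absurd hy hm₂
        · exact h
      have hm₁' : ∀ x ∈ l₁, x < m := fun x hx => hltm x (hS'₁ x hx)
      have hm₂' : ∀ y ∈ l₂, y < m := fun y hy => hltm y (hS'₂ y hy)
      -- no `132`: the letters after `m` lie below the letters before `m`
      have hbelow : ∀ x ∈ l₁, ∀ y ∈ l₂, y < x := fun x hx y hy =>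
        lt_of_le_of_ne (not_lt.mp fun hxy => h132 ((has132_append_max_iff l₁ l₂ m hm₁' hm₂').mpr
          (Or.inr (Or.inr ⟨x, hx, y, hy, hxy⟩)))) fun h => hdis x hx y (List.mem_cons_of_mem m hy) h.symm
      by_cases h₂ : l₂ = []
      · subst h₂
        refine Or.inl ⟨l₁, ?_, rfl⟩
        rw [hmem_av]
        refine ⟨⟨hn₁, fun x => ⟨hS'₁ x, fun hx => ?_⟩⟩, fun h => h132 ?_, fun h => h321 ?_⟩
        · have := (hmem x).mpr ((hmemS x).mpr (Or.inr hx))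
          rw [List.mem_append, List.mem_singleton] at this
          rcases this with h | rfl
          · exact h
          · exact absurd hx hmS'
        · obtain ⟨a, b, c, hs, hh⟩ := h
          exact ⟨a, b, c, hs.trans (List.sublist_append_left l₁ [m]), hh⟩
        · obtain ⟨a, b, c, hs, hh⟩ := h
          exact ⟨a, b, c, hs.trans (List.sublist_append_left l₁ [m]), hh⟩
      -- `l₂ ≠ []`: both parts increase (no `321`), so the word is `w j`, `j = |l₂|`
      right
      obtain ⟨y₀, hy₀⟩ := List.exists_mem_of_ne_nil l₂ h₂
      have hincr₂ : l₂.Pairwise (· < ·) := pairwise_lt_of_not_has21 hn₂ fun ⟨b, c, hs, hcb⟩ =>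
        h321 ((has321_append_max_iff l₁ l₂ m hm₁' hm₂').mpr (Or.inr (Or.inl ⟨b, c, hs, hcb⟩)))
      have hincr₁ : l₁.Pairwise (· < ·) := pairwise_lt_of_not_has21 hn₁ fun ⟨a, b, hs, hba⟩ =>
        h321 ((has321_append_max_iff l₁ l₂ m hm₁' hm₂').mpr
          (Or.inr (Or.inr ⟨a, b, hs, hba, y₀, hy₀, hbelow b (hs.subset (by simp)) y₀ hy₀⟩)))
      have hsplit' : ∀ x, x ∈ S' ↔ x ∈ l₁.toFinset ∨ x ∈ l₂.toFinset := fun x => by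
        rw [List.mem_toFinset, List.mem_toFinset]
        constructor
        · intro hx
          have hxS : x ∈ S := Finset.mem_of_mem_erase hx
          rcases List.mem_append.mp ((hmem x).mpr hxS) with h | h
          · exact Or.inl h
          · rcases List.mem_cons.mp h with rfl | h
            · exact absurd hx hmS'
            · exact Or.inr h
        · rintro (hx | hx)
          · exact hS'₁ x hx
          · exact hS'₂ x hx
      have hB := eq_filter_rank_lt_of_forall_lt S' l₁.toFinset l₂.toFinset hsplit' fun x hx y hy =>
        hbelow x (List.mem_toFinset.mp hx) y (List.mem_toFinset.mp hy)
      set j := l₂.toFinset.card with hj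
      have hB' : l₂.toFinset = low j := hB
      have hjl : j = l₂.length := by rw [hj, List.toFinset_card_of_nodup hn₂]
      have hj1 : 1 ≤ j := by
        rw [hjl]
        exact List.length_pos_of_ne_nil h₂
      have hjn : j ≤ n := by
        simp only [List.length_append, List.length_cons] at hlen
        omega
      refine ⟨j, hj1, hjn, ?_⟩
      have e₂ : l₂ = ((low j).sort : List α) :=
        eq_sort_of_pairwise_lt hincr₂ fun x => by rw [← hB', List.mem_toFinset]
      have e₁ : l₁ = ((S' \ low j).sort : List α) := by
        refine eq_sort_of_pairwise_lt hincr₁ fun x => ?_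
        rw [Finset.mem_sdiff, ← hB', List.mem_toFinset]
        constructor
        · intro hx
          exact ⟨hS'₁ x hx, fun hx' => hdis x hx x (List.mem_cons_of_mem m hx') rfl⟩
        · rintro ⟨hx, hx'⟩
          rcases (hsplit' x).mp hx with h | h
          · exact List.mem_toFinset.mp h
          · exact absurd (List.mem_toFinset.mp h) hx'
      rw [hw]
      simp only []
      rw [← e₁, ← e₂]
    -- hence `av S = (av S') · m ∪ {w 1, …, w n}`
    have hU : av S = (av S').image (fun l => l ++ [m]) ∪ (Finset.Icc 1 n).image w := by
      ext l
      simp only [Finset.mem_union, Finset.mem_image, Finset.mem_Icc]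
      constructor
      · intro hl
        rcases hsplit l hl with ⟨l', hl', h⟩ | ⟨j, hj1, hjn, h⟩
        · exact Or.inl ⟨l', hl', h.symm⟩
        · exact Or.inr ⟨j, ⟨hj1, hjn⟩, h.symm⟩
      · rintro (⟨l', hl', rfl⟩ | ⟨j, -, rfl⟩)
        · exact hsnoc l' hl'
        · exact hw_mem j
    have ih' := ih S' hS'
    rw [hS'] at ih'
    rw [hU, Finset.card_union_of_disjoint, Finset.card_image_of_injective _ (fun l l' h => List.append_cancel_right h),
      Finset.card_image_of_injOn, Nat.card_Icc, ih', hn, Nat.add_sub_cancel, Nat.choose_succ_succ, Nat.choose_one_right]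
    · ring
    · -- `w` is injective on `[1, n]`: the part after `m` has `j` letters
      intro j hj j' hj' he
      have hjn : j ≤ n := (Finset.mem_Icc.mp (Finset.mem_coe.mp hj)).2
      have hj'n : j' ≤ n := (Finset.mem_Icc.mp (Finset.mem_coe.mp hj')).2
      have h2 := (append_cons_inj_of_notMem (hmA j) (hmA j') he).2
      have := congrArg List.length h2
      rwa [Finset.length_sort, Finset.length_sort, hlow_card j hjn, hlow_card j' hj'n] at this
    · -- the two families are disjoint: nothing follows `m` in the first, `j ≥ 1` letters do in the second
      rw [Finset.disjoint_left]
      intro l hl hl'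
      rw [Finset.mem_image] at hl hl'
      obtain ⟨l', hl'av, rfl⟩ := hl
      obtain ⟨j, hj, he⟩ := hl'
      rw [Finset.mem_Icc] at hj
      rw [hmem_av] at hl'av
      have hml' : m ∉ l' := fun h => hmS' ((hl'av.1.2 m).mp h)
      have h2 := (append_cons_inj_of_notMem (hmA j) hml' he).2
      have := congrArg List.length h2
      rw [Finset.length_sort, hlow_card j hj.2, List.length_nil] at this
      omega

/-- ★★★ **PROPOSITION 11 (Simion–Schmidt 1985)** «For all `n ≥ 1`, `A_n(132, 321) = C(n, 2) + 1`»: the number of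
permutations of length `n` avoiding both `132` and `321` (stated for every `n`; both sides are `1` at `n = 0`).
[cite: SimionSchmidt1985, Proposition 11 (held text p0011)] -/
theorem card_av132_av321 (n : ℕ) :
    Nat.card {v : Perm (Fin n) // ¬ PermContainsPattern v ![1, 3, 2] ∧ ¬ PermContainsPattern v ![3, 2, 1]} =
      n.choose 2 + 1 := by
  classical
  refine (natCard_perm_eq_card_filter_arrangements n
    (fun v : Perm (Fin n) => ¬ PermContainsPattern v ![1, 3, 2] ∧ ¬ PermContainsPattern v ![3, 2, 1])
    (fun l : List ℕ => (¬ ∃ a b c : ℕ, [a, b, c].Sublist l ∧ a < c ∧ c < b) ∧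
      ¬ ∃ a b c : ℕ, [a, b, c].Sublist l ∧ c < b ∧ b < a)
    (fun v => by rw [has132_ofFn_perm_iff, has321_ofFn_perm_iff])).trans ?_
  rw [card_arrangements_not132_not321 (α := ℕ) (Finset.range n), Finset.card_range]

/-- PROPOSITION 11, the recurrence behind it: `A_{n+1}(132, 321) = A_n(132, 321) + n`.
[cite: SimionSchmidt1985, Proposition 11 (proof, held text p0011)] -/
theorem card_av132_av321_succ (n : ℕ) :
    Nat.card {v : Perm (Fin (n + 1)) // ¬ PermContainsPattern v ![1, 3, 2] ∧ ¬ PermContainsPattern v ![3, 2, 1]} =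
      Nat.card {v : Perm (Fin n) // ¬ PermContainsPattern v ![1, 3, 2] ∧ ¬ PermContainsPattern v ![3, 2, 1]} + n := by
  rw [card_av132_av321, card_av132_av321, Nat.choose_succ_succ, Nat.choose_one_right]
  ring

/-- PROPOSITION 11 with LEMMA 5 (e): `A_n(123, 231) = C(n, 2) + 1`. [cite: SimionSchmidt1985, Proposition 11 and
Lemma 5 (e) (held text p0010–p0011)] -/
theorem card_av123_av231 (n : ℕ) :
    Nat.card {v : Perm (Fin n) // ¬ PermContainsPattern v ![1, 2, 3] ∧ ¬ PermContainsPattern v ![2, 3, 1]} =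
      n.choose 2 + 1 := by
  rw [← card_av132_av321_eq_card_av123_av231, card_av132_av321]

/-- PROPOSITION 11 with LEMMA 5 (e): `A_n(123, 312) = C(n, 2) + 1`. [cite: SimionSchmidt1985, Proposition 11 and
Lemma 5 (e) (held text p0010–p0011)] -/
theorem card_av123_av312 (n : ℕ) :
    Nat.card {v : Perm (Fin n) // ¬ PermContainsPattern v ![1, 2, 3] ∧ ¬ PermContainsPattern v ![3, 1, 2]} =
      n.choose 2 + 1 := by
  rw [← card_av132_av321_eq_card_av123_av312, card_av132_av321]

/-- PROPOSITION 11 with LEMMA 5 (e): `A_n(213, 321) = C(n, 2) + 1`. [cite: SimionSchmidt1985, Proposition 11 and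
Lemma 5 (e) (held text p0010–p0011)] -/
theorem card_av213_av321 (n : ℕ) :
    Nat.card {v : Perm (Fin n) // ¬ PermContainsPattern v ![2, 1, 3] ∧ ¬ PermContainsPattern v ![3, 2, 1]} =
      n.choose 2 + 1 := by
  rw [← card_av132_av321_eq_card_av213_av321, card_av132_av321]

/-- Sanity values `A_3 = 4`, `A_4 = 7` for `(132, 321)` (the printed `1 + C(n,2)`). [cite: SimionSchmidt1985,
Proposition 11 (held text p0011)] -/
theorem card_av132_av321_three_four :
    Nat.card {v : Perm (Fin 3) // ¬ PermContainsPattern v ![1, 3, 2] ∧ ¬ PermContainsPattern v ![3, 2, 1]} = 4 ∧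
      Nat.card {v : Perm (Fin 4) // ¬ PermContainsPattern v ![1, 3, 2] ∧ ¬ PermContainsPattern v ![3, 2, 1]} = 7 :=
  ⟨by rw [card_av132_av321]; rfl, by rw [card_av132_av321]; rfl⟩

end Prop11

end PermContainsPattern

end Literature.Combinatorics.Enumerative
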